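import Summits.QuantumAdvantage.AdviceFreeQNC0.CubeTransfer
import Summits.QuantumAdvantage.AdviceFreeQNC0.CubeCharacterSums
import Summits.QuantumAdvantage.AdviceFreeQNC0.WalshModThree
import HarnessLib

/-!
# Cell qa-qnc0 (rung F-Q1, route RingFrame, crux α, line `product`): cube geometry for `CubeCover` —
# generator change, generator pinning, and the two vertex families

Set-up for planner qa-qnc0-p1's T6(b) `CubeCover` (HOME/qa-qnc0-p1/ROUND-8.md §1(b)), in COLUMN
coordinates `a : Fin L → (Fin (D+1) → Bool)` (column `ℓ` of the generator matrix), so that the column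
sums of `CubeCharacterSums.lean` apply verbatim; `cubeVertex x (fun i ℓ => a ℓ i) S = vert x a S` by `rfl`.

* `goodCfg D x r` = configurations all of whose `2^{D+1} − 1` positive vertices `x + a_S` lie in class
  `r`; `card_goodCfg_eq_count`: its size is the count of `CubeCharacterSums` for the ONE-BASE-POINT
  family (`base1`, `read1`, `dom1`; labels `PosSub D` = nonempty `S ⊆ [D+1]`).
* GENERATOR CHANGE `regen S i a` (replace generator `i ∈ S` by `a_S`): injective, preserves `goodCfg`
  (the vertex SET is unchanged: `vert_regen_of_mem` relabels `T ∋ i` to `(T ∖ i) ∆ S`), and moves the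
  vertex `S` to the generator vertex `{i}` (`vert_regen_singleton`) — so a bad vertex may be assumed
  to be a generator.
* GENERATOR PINNING: the configurations of `goodCfg` whose generator vertex `x + a_i` equals `y` form
  a subset of the count for the TWO-BASE-POINT family (`base2`, `read2`, `dom2`: vertices `x + a_R`,
  `y + a_R` over nonempty `R ∌ i`, column `i` frozen to `x ⊕ y`): `card_filter_goodCfg_pin_le_count`.
* sizes: `card_dom2` (`2^D` columns with a frozen bit), `card_posSub` (`2^{D+1} − 1`),
  `card_freeSub` (`2^D − 1`).

WHAT THIS IS NOT: no counting estimate yet (`CubeCoverCounts.lean`), nothing on `FSB`/α.  [folklore]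
-/

namespace Summit.QuantumAdvantage.AdviceFreeQNC0

namespace CubeChar

open Finset

variable {L D : ℕ}

/-! ### Vertices in column coordinates -/

/-- The vertex `x + a_S` of the cube with base `x` and generator columns `a`. -/
def vert (x : Fin L → Bool) (a : Fin L → (Fin (D + 1) → Bool)) (S : Finset (Fin (D + 1))) :
    Fin L → Bool :=
  fun ℓ => xor (x ℓ) (subsetPar S (a ℓ))

/-- Column coordinates are the transpose of `cubeVertex`'s row coordinates. -/
theorem cubeVertex_transpose (x : Fin L → Bool) (a : Fin L → (Fin (D + 1) → Bool))
    (S : Finset (Fin (D + 1))) : cubeVertex x (fun i ℓ => a ℓ i) S = vert x a S := rfl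

variable (D) in
/-- Configurations all of whose positive vertices lie in class `r`. -/
def goodCfg (x : Fin L → Bool) (r : ℕ) : Finset (Fin L → (Fin (D + 1) → Bool)) :=
  univ.filter fun a => ∀ S : Finset (Fin (D + 1)), S.Nonempty → vert x a S ∈ cls L r

/-! ### Generator change: replace generator `i ∈ S` by `a_S` -/

/-- Replace the `i`-th generator by `a_S` (columnwise: bit `i` becomes `⟨1_S, a ℓ⟩`). -/
def regen (S : Finset (Fin (D + 1))) (i : Fin (D + 1)) (a : Fin L → (Fin (D + 1) → Bool)) :
    Fin L → (Fin (D + 1) → Bool) :=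
  fun ℓ => Function.update (a ℓ) i (subsetPar S (a ℓ))

/-- After the change the generator vertex `{i}` is the old vertex `S`. -/
theorem vert_regen_singleton (x : Fin L → Bool) (a : Fin L → (Fin (D + 1) → Bool))
    (S : Finset (Fin (D + 1))) (i : Fin (D + 1)) : vert x (regen S i a) {i} = vert x a S := by
  funext ℓ
  unfold vert regen
  rw [subsetPar_singleton, Function.update_self]

/-- Vertices not involving generator `i` are unchanged. -/
theorem vert_regen_of_notMem (x : Fin L → Bool) (a : Fin L → (Fin (D + 1) → Bool))
    (S : Finset (Fin (D + 1))) {i : Fin (D + 1)} {T : Finset (Fin (D + 1))} (hiT : i ∉ T) :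
    vert x (regen S i a) T = vert x a T := by
  funext ℓ
  unfold vert regen
  rw [subsetPar_update_of_notMem hiT]

/-- Vertices involving generator `i` are relabelled: `T ↦ (T ∖ {i}) ∆ S`. -/
theorem vert_regen_of_mem (x : Fin L → Bool) (a : Fin L → (Fin (D + 1) → Bool))
    {S : Finset (Fin (D + 1))} {i : Fin (D + 1)} {T : Finset (Fin (D + 1))} (hiT : i ∈ T) :
    vert x (regen S i a) T = vert x a (symmDiff (T.erase i) S) := by
  funext ℓ
  unfold vert regen
  have hT : subsetPar T (a ℓ) = xor (a ℓ i) (subsetPar (T.erase i) (a ℓ)) := by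
    rw [← subsetPar_insert (Finset.notMem_erase i T), Finset.insert_erase hiT]
  rw [subsetPar_update_of_mem hiT, subsetPar_symmDiff, hT]
  generalize x ℓ = p
  generalize a ℓ i = q
  generalize subsetPar S (a ℓ) = u
  generalize subsetPar (T.erase i) (a ℓ) = w
  cases p <;> cases q <;> cases u <;> cases w <;> rfl

/-- The generator change keeps every positive vertex in class `r`. -/
theorem regen_mem_goodCfg {x : Fin L → Bool} {r : ℕ} {a : Fin L → (Fin (D + 1) → Bool)}
    {S : Finset (Fin (D + 1))} {i : Fin (D + 1)} (hiS : i ∈ S) (ha : a ∈ goodCfg D x r) :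
    regen S i a ∈ goodCfg D x r := by
  unfold goodCfg at ha ⊢
  rw [Finset.mem_filter] at ha ⊢
  refine ⟨Finset.mem_univ _, fun T hT => ?_⟩
  by_cases hiT : i ∈ T
  · rw [vert_regen_of_mem x a hiT]
    exact ha.2 _ ⟨i, Finset.mem_symmDiff.2 (Or.inr ⟨hiS, Finset.notMem_erase i T⟩)⟩
  · rw [vert_regen_of_notMem x a S hiT]
    exact ha.2 T hT

/-- The generator change is injective (generator `i` is recovered from `⟨1_S, ·⟩`, `i ∈ S`). -/
theorem regen_injective {S : Finset (Fin (D + 1))} {i : Fin (D + 1)} (hiS : i ∈ S) :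
    Function.Injective (regen (L := L) S i) := by
  intro a a' h
  funext ℓ j
  have hℓ := congrFun h ℓ
  have hrest : ∀ k, k ≠ i → a ℓ k = a' ℓ k := fun k hk => by
    have := congrFun hℓ k
    unfold regen at this
    rwa [Function.update_of_ne hk, Function.update_of_ne hk] at this
  by_cases hj : j = i
  · rw [hj]
    have hpar : subsetPar S (a ℓ) = subsetPar S (a' ℓ) := by
      have := congrFun hℓ i
      unfold regen at this
      rwa [Function.update_self, Function.update_self] at this
    rw [← Finset.insert_erase hiS, subsetPar_insert (Finset.notMem_erase i S),
      subsetPar_insert (Finset.notMem_erase i S),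
      subsetPar_congr (R := S.erase i) (fun k hk => hrest k (Finset.ne_of_mem_erase hk))] at hpar
    revert hpar
    generalize a ℓ i = p
    generalize a' ℓ i = q
    generalize subsetPar (S.erase i) (a' ℓ) = u
    cases p <;> cases q <;> cases u <;> simp
  · exact hrest j hj

/-! ### Generator pinning -/

/-- If the generator vertex `x + a_i` is `y`, the `i`-th generator is `x ⊕ y`. -/
theorem apply_eq_of_vert_singleton {x y : Fin L → Bool} {a : Fin L → (Fin (D + 1) → Bool)}
    {i : Fin (D + 1)} (h : vert x a {i} = y) (ℓ : Fin L) : a ℓ i = xor (x ℓ) (y ℓ) := by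
  have := congrFun h ℓ
  unfold vert at this
  rw [subsetPar_singleton] at this
  revert this
  generalize x ℓ = p
  generalize a ℓ i = q
  generalize y ℓ = u
  cases p <;> cases q <;> cases u <;> simp

/-- With generator `i` pinned to `x ⊕ y`, the vertices through `i` are the cube at `y`:
`x + a_{R ∪ {i}} = y + a_R`. -/
theorem vert_insert_of_pin {x y : Fin L → Bool} {a : Fin L → (Fin (D + 1) → Bool)}
    {i : Fin (D + 1)} {R : Finset (Fin (D + 1))} (hiR : i ∉ R)
    (hz : ∀ ℓ, a ℓ i = xor (x ℓ) (y ℓ)) : vert x a (insert i R) = vert y a R := by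
  funext ℓ
  unfold vert
  rw [subsetPar_insert hiR, hz ℓ]
  generalize x ℓ = p
  generalize y ℓ = q
  generalize subsetPar R (a ℓ) = u
  cases p <;> cases q <;> cases u <;> rfl

/-! ### The two vertex families -/

variable (D) in
/-- Labels of the positive vertices: nonempty `S ⊆ [D+1]`. -/
abbrev PosSub : Type := {S : Finset (Fin (D + 1)) // S.Nonempty}

variable (D) in
/-- Labels of the free vertices after pinning generator `i`: nonempty `R ⊆ [D+1] ∖ {i}`. -/
abbrev FreeSub (i : Fin (D + 1)) : Type := {R : Finset (Fin (D + 1)) // R.Nonempty ∧ i ∉ R}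

/-- One base point: every vertex starts at `x`. -/
def base1 (x : Fin L → Bool) : PosSub D → Fin L → Bool := fun _ => x

variable (D) in
/-- One base point: vertex `S` reads `⟨1_S, α⟩`. -/
def read1 : PosSub D → (Fin (D + 1) → Bool) → Bool := fun S α => subsetPar S.1 α

variable (L D) in
/-- One base point: all columns free. -/
def dom1 : Fin L → Finset (Fin (D + 1) → Bool) := fun _ => univ

/-- Two base points: vertices `(false, R)` start at `x`, vertices `(true, R)` at `y`. -/
def base2 {i : Fin (D + 1)} (x y : Fin L → Bool) : Bool × FreeSub D i → Fin L → Bool :=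
  fun j => cond j.1 y x

/-- Two base points: vertex `(b, R)` reads `⟨1_R, α⟩`. -/
def read2 {i : Fin (D + 1)} : Bool × FreeSub D i → (Fin (D + 1) → Bool) → Bool :=
  fun j α => subsetPar j.2.1 α

/-- Two base points: column `ℓ` has its `i`-th bit frozen to `z ℓ`. -/
def dom2 (i : Fin (D + 1)) (z : Fin L → Bool) : Fin L → Finset (Fin (D + 1) → Bool) :=
  fun ℓ => univ.filter fun α => α i = z ℓ

/-- `#goodCfg` is the one-base-point count. -/
theorem card_goodCfg_eq_count (x : Fin L → Bool) (r : ℕ) :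
    (goodCfg D x r).card = count (base1 x) (read1 D) (dom1 L D) r := by
  unfold goodCfg count dom1
  rw [Fintype.piFinset_univ]
  congr 1
  exact Finset.filter_congr fun a _ => ⟨fun h j => h j.1 j.2, fun h S hS => h ⟨S, hS⟩⟩

/-- The pinned configurations of `goodCfg` lie in the two-base-point count. -/
theorem card_filter_goodCfg_pin_le_count (x y : Fin L → Bool) (i : Fin (D + 1)) (r : ℕ) :
    ((goodCfg D x r).filter fun a => vert x a {i} = y).card ≤
      count (base2 (i := i) x y) read2 (dom2 i fun ℓ => xor (x ℓ) (y ℓ)) r := by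
  unfold count
  refine Finset.card_le_card fun a ha => ?_
  rw [Finset.mem_filter] at ha ⊢
  obtain ⟨hgood, hpin⟩ := ha
  unfold goodCfg at hgood
  rw [Finset.mem_filter] at hgood
  have hz : ∀ ℓ, a ℓ i = xor (x ℓ) (y ℓ) := apply_eq_of_vert_singleton hpin
  refine ⟨?_, ?_⟩
  · rw [Fintype.mem_piFinset]
    intro ℓ
    unfold dom2
    rw [Finset.mem_filter]
    exact ⟨Finset.mem_univ _, hz ℓ⟩
  · rintro ⟨b, R⟩
    cases b
    · exact hgood.2 R.1 R.2.1
    · change vert y a R.1 ∈ cls L r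
      rw [← vert_insert_of_pin R.2.2 hz]
      exact hgood.2 _ (Finset.insert_nonempty _ _)

/-! ### Sizes -/

/-- Half of the columns have a prescribed bit: `#{α : α i = b} = 2^D`. -/
theorem card_filter_apply_eq (i : Fin (D + 1)) (b : Bool) :
    ((univ : Finset (Fin (D + 1) → Bool)).filter fun α => α i = b).card = 2 ^ D := by
  have hflip : ∀ b : Bool, ((univ : Finset (Fin (D + 1) → Bool)).filter fun α => α i = b).card =
      ((univ : Finset (Fin (D + 1) → Bool)).filter fun α => α i = !b).card := by
    intro b
    refine Finset.card_bij (fun α _ => flipBit i α) ?_ ?_ ?_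
    · intro α hα
      rw [Finset.mem_filter] at hα ⊢
      exact ⟨Finset.mem_univ _, by simp [flipBit, hα.2]⟩
    · intro α₁ _ α₂ _ h
      rw [← flipBit_flipBit i α₁, h, flipBit_flipBit]
    · intro β hβ
      refine ⟨flipBit i β, ?_, flipBit_flipBit i β⟩
      rw [Finset.mem_filter] at hβ ⊢
      exact ⟨Finset.mem_univ _, by simp [flipBit, hβ.2]⟩
  have htot := Finset.card_filter_add_card_filter_not
    (s := (univ : Finset (Fin (D + 1) → Bool))) (fun α => α i = true)
  rw [Finset.card_univ, Fintype.card_fun, Fintype.card_bool, Fintype.card_fin] at htot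
  have hneg : ((univ : Finset (Fin (D + 1) → Bool)).filter fun α => ¬ α i = true) =
      univ.filter fun α => α i = false := Finset.filter_congr fun α _ => by simp
  rw [hneg] at htot
  have h1 := hflip true
  simp only [Bool.not_true] at h1
  have h2 : 2 ^ (D + 1) = 2 * 2 ^ D := by ring
  cases b <;> omega

/-- The frozen-bit column domains have size `2^D`. -/
theorem card_dom2 (i : Fin (D + 1)) (z : Fin L → Bool) (ℓ : Fin L) : (dom2 i z ℓ).card = 2 ^ D :=
  card_filter_apply_eq i (z ℓ)

/-- The free column domains have size `2^{D+1}`. -/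
theorem card_dom1 (ℓ : Fin L) : (dom1 L D ℓ).card = 2 ^ (D + 1) := by
  unfold dom1
  rw [Finset.card_univ, Fintype.card_fun, Fintype.card_bool, Fintype.card_fin]

/-- There are `2^{D+1} − 1` positive vertices. -/
theorem card_posSub : Fintype.card (PosSub D) = 2 ^ (D + 1) - 1 := by
  rw [Fintype.card_subtype]
  have h := card_filter_nonempty_add_one D
  omega

/-- There are `2^D − 1` free labels after pinning a generator. -/
theorem card_freeSub (i : Fin (D + 1)) : Fintype.card (FreeSub D i) = 2 ^ D - 1 := by
  rw [Fintype.card_subtype]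
  have e : ((univ : Finset (Finset (Fin (D + 1)))).filter fun R => R.Nonempty ∧ i ∉ R) =
      ((univ.erase i).powerset).erase ∅ := by
    ext R
    simp only [Finset.mem_filter, Finset.mem_univ, true_and, Finset.mem_erase, Finset.mem_powerset]
    constructor
    · rintro ⟨hR, hi⟩
      exact ⟨hR.ne_empty, fun j hj => Finset.mem_erase.2 ⟨ne_of_mem_of_not_mem hj hi, Finset.mem_univ _⟩⟩
    · rintro ⟨hR, hsub⟩
      exact ⟨Finset.nonempty_iff_ne_empty.2 hR, fun hi => by simpa using hsub hi⟩
  rw [e, Finset.card_erase_of_mem (Finset.empty_mem_powerset _), Finset.card_powerset,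
    Finset.card_erase_of_mem (Finset.mem_univ i), Finset.card_univ, Fintype.card_fin]
  simp

/-- The two-base-point family has `2^{D+1} − 2` vertices. -/
theorem card_bool_prod_freeSub (i : Fin (D + 1)) :
    Fintype.card (Bool × FreeSub D i) = 2 ^ (D + 1) - 2 := by
  rw [Fintype.card_prod, Fintype.card_bool, card_freeSub]
  have h : 1 ≤ 2 ^ D := Nat.one_le_two_pow
  have h2 : 2 ^ (D + 1) = 2 * 2 ^ D := by ring
  omega

end CubeChar

end Summit.QuantumAdvantage.AdviceFreeQNC0
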